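import Mathlib
import HarnessLib
import Summits.NavierStokesRegularity.NavierStokesRegularity.Theorems.PoloidalWindowDoorLrcModEntireRidgeWebImplicit

/-!
# Route `PoloidalWindowDoor`, item `LrcModEntire` (stmt-NavierStokesRegularity-20428), cell (Q4) of the (TH) column —
# THE WEB FUNCTION IS ANALYTIC (class-free; brick P1.1 of LEAD memo T2B-g16 §2/§6(iii))

Cell ns-regularity-ideate, LEAD-lineage seat ns-poloidal-K2-p3 g16 (`--supports stmt-NavierStokesRegularity-20428`).
`C^ω` twin of port-2's `…RidgeWebImplicit.hasStrictFDerivAt_criticalPoint`: the interior critical point `n₀(p)` of a family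
`n ↦ G(p, n)` of strictly concave cross-sections which is `C^ω` in `(p, n)` is a `C^ω` function of the parameter `p`
(`contDiffAt_criticalPoint`: Mathlib's `ContDiffAt.implicitFunction` for `f = ∂ₙG`, identified with `n₀` near `p₀` by the
uniqueness of the critical point, `eq_of_partial_eq_zero`).  Used by the wiring of `stub_Q4line` to make the web offset `d(z)`
of the homogeneous web an analytic function of the height.

WHAT THIS IS NOT: not a claim about Navier–Stokes regularity; calculus (bears_on LADDER-NS N0 via item 20428).
-/

noncomputable section

set_option linter.dupNamespace false
set_option linter.unusedVariables false

namespace Summit.NavierStokesRegularity.NavierStokesRegularity.Theorems.PoloidalWindowDoorLrcModEntireWebFunction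

open Set Function Filter Topology Metric
open scoped ContDiff
open Summit.NavierStokesRegularity.NavierStokesRegularity.Theorems.PoloidalWindowDoorLrcModEntireRidgeWebImplicit

variable {P : Type*} [NormedAddCommGroup P] [NormedSpace ℝ P] [CompleteSpace P]

/-- **THE CRITICAL POINT IS `C^ω` (implicit function theorem).**  `V` open; for `p ∈ V` and `|n| < r`, `G` is `C^ω` at `(p, n)`
and `∂ₙ∂ₙG(p,n) < 0`; `n₀ p ∈ (−r, r)` with `∂ₙG(p, n₀ p) = 0` for `p ∈ V`.  Then `n₀` is `C^ω` at every `p₀ ∈ V`. -/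
theorem contDiffAt_criticalPoint {G : P × ℝ → ℝ} {V : Set P} (hV : IsOpen V) {r : ℝ}
    (hG : ∀ p ∈ V, ∀ n ∈ Ioo (-r) r, ContDiffAt ℝ ω G (p, n))
    (hconc : ∀ p ∈ V, ∀ n ∈ Ioo (-r) r, fderiv ℝ (fderiv ℝ G) (p, n) ((0 : P), (1 : ℝ)) ((0 : P), (1 : ℝ)) < 0)
    {n₀ : P → ℝ} (hn₀ : ∀ p ∈ V, n₀ p ∈ Ioo (-r) r) (hcrit : ∀ p ∈ V, fderiv ℝ G (p, n₀ p) ((0 : P), (1 : ℝ)) = 0)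
    {p₀ : P} (hp₀ : p₀ ∈ V) : ContDiffAt ℝ ω n₀ p₀ := by
  set f : P × ℝ → ℝ := fun v => fderiv ℝ G v ((0 : P), (1 : ℝ)) with hf
  set u : P × ℝ := (p₀, n₀ p₀) with hu
  have hGd : ∀ p ∈ V, ∀ n ∈ Ioo (-r) r, DifferentiableAt ℝ (fderiv ℝ G) (p, n) := fun p hp n hn =>
    ((hG p hp n hn).fderiv_right (m := 1) (by norm_cast)).differentiableAt (by simp)
  -- `f` is `C^ω` at `u`
  have hfω : ContDiffAt ℝ ω f u := by
    have h := (hG p₀ hp₀ _ (hn₀ p₀ hp₀)).fderiv_right (m := ω) le_rfl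
    set A : (P × ℝ →L[ℝ] ℝ) →L[ℝ] ℝ := ContinuousLinearMap.apply ℝ ℝ ((0 : P), (1 : ℝ)) with hA
    have e : f = A ∘ fderiv ℝ G := by funext v; simp [hf, hA]
    rw [e]; exact A.contDiff.contDiffAt.comp u h
  -- the fibre derivative is the (negative) number `∂ₙ∂ₙG(u)`, so `f′ ∘ inr` is invertible
  have if₂u : (fderiv ℝ f u ∘L ContinuousLinearMap.inr ℝ P ℝ).IsInvertible := by
    set L : ℝ →L[ℝ] ℝ := fderiv ℝ f u ∘L ContinuousLinearMap.inr ℝ P ℝ with hL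
    have hL1 : L 1 ≠ 0 := by
      rw [hL, ContinuousLinearMap.comp_apply, ContinuousLinearMap.inr_apply, hf, fderiv_partial_apply (hGd p₀ hp₀ _ (hn₀ p₀ hp₀))]
      exact (hconc p₀ hp₀ _ (hn₀ p₀ hp₀)).ne
    refine ⟨ContinuousLinearEquiv.unitsEquivAut ℝ (Units.mk0 (L 1) hL1), ?_⟩
    ext
    simp
  have hω0 : (ω : ℕ∞ω) ≠ 0 := by simp
  -- the implicit function and its properties
  set ψ := hfω.implicitFunction hω0 if₂u with hψ
  have hψω : ContDiffAt ℝ ω ψ p₀ := hfω.contDiffAt_implicitFunction hω0 if₂u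
  have hψ0 : ψ p₀ = n₀ p₀ := hfω.implicitFunction_apply_self hω0 if₂u
  have hψeq : ∀ᶠ p in 𝓝 p₀, f (p, ψ p) = f u := hfω.eventually_apply_implicitFunction hω0 if₂u
  have hψc : ContinuousAt ψ p₀ := hψω.continuousAt
  -- `ψ = n₀` near `p₀`: both are critical points in `(−r, r)` of a strictly concave cross-section
  have hfu : f u = 0 := hcrit p₀ hp₀
  have hev : ∀ᶠ p in 𝓝 p₀, ψ p = n₀ p := by
    have h1 : ∀ᶠ p in 𝓝 p₀, p ∈ V := hV.mem_nhds hp₀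
    have h2 : ∀ᶠ p in 𝓝 p₀, ψ p ∈ Ioo (-r) r := by
      have : Tendsto ψ (𝓝 p₀) (𝓝 (n₀ p₀)) := by rw [← hψ0]; exact hψc
      exact this (isOpen_Ioo.mem_nhds (hn₀ p₀ hp₀))
    filter_upwards [h1, h2, hψeq] with p hp hψp hq
    rw [hfu] at hq
    exact eq_of_partial_eq_zero (hGd p hp) (hconc p hp) hψp (hn₀ p hp) hq (hcrit p hp)
  exact hψω.congr_of_eventuallyEq (hev.mono fun p hp => hp.symm)

end Summit.NavierStokesRegularity.NavierStokesRegularity.Theorems.PoloidalWindowDoorLrcModEntireWebFunction
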